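import Literature.Probability.RandomPlanarGeometry.SLESameSideKernel
import Mathlib.MeasureTheory.Integral.IntegralEqImproper
import Mathlib.Analysis.SpecialFunctions.ImproperIntegrals
import Mathlib.Analysis.SpecialFunctions.Integrability.Basic
import HarnessLib

/-!
# The same-side scale function at the two ends of `(1, ∞)`: `h(1+)` and `h(∞)`

Trunk T-STOCH; deterministic special-function layer, continued from `SLESameSideKernel`
(`sameSideKernel a u = u^{-2a}(u-1)^{-2a}`, `sameSideH a z = ∫₂ᶻ` of it). For the **sharp**
same-side two-point law of the real SLE_κ flow (S. Rohde, O. Schramm, *Basic properties of SLE*,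
Ann. of Math. 161 (2005), Lemma 6.6: `P[T_y = T_x] = (h(z₀) - h(1+))/(h(∞) - h(1+))`,
`z₀ = x/(x-y)`, `h = sameSideH (2/κ)`) both end values of the scale function are needed:

* `h(1+)`: for `a < 1/2` (`κ > 4`) the kernel is integrable at `1` (`(u-1)^{-2a}`, `-2a > -1`;
  `intervalIntegrable_sameSideKernel_one`), so `sameSideH a 1 = -∫₁² K_a` is the genuine right
  limit `h(1+)` (`tendsto_sameSideH_one`: `h` is continuous on `[1, ∞)`), and
  `h(z) - h(1) = ∫₁ᶻ K_a > 0` for `z > 1` (`sameSideH_sub_one`, `sameSideH_one_lt`);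
* `h(∞)`: for `a > 1/4` (`κ < 8`) the kernel is integrable at `∞` (`K_a ≤ 2^{2a} u^{-4a}`,
  `sameSideKernel_le`; `integrableOn_sameSideKernel_Ioi`), `sameSideHTop a := ∫_{(2,∞)} K_a` is
  the limit of `h` at `+∞` (`tendsto_sameSideH_atTop`) and a strict upper bound
  (`sameSideH_lt_sameSideHTop`); `sameSideHTop a - sameSideH a 1 = ∫_{(1,∞)} K_a`
  (`sameSideHTop_sub_sameSideH_one`).

## References

* S. Rohde, O. Schramm, *Basic properties of SLE*, Ann. of Math. 161 (2005), Lemma 6.6, eq. (6.13).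
* G. F. Lawler, *Conformally Invariant Processes in the Plane*, AMS (2005), Prop. 6.34, eq. (6.21).
-/

noncomputable section

open Set Filter Topology MeasureTheory intervalIntegral
open scoped NNReal

namespace Literature.Probability.RandomPlanarGeometry

variable {a : ℝ}

/-! ### The end `1`: integrability for `a < 1/2` and the value `h(1)` -/

/-- **The kernel is integrable at `1` when `a < 1/2`**: `K_a = u^{-2a} · (u-1)^{-2a}` is a
continuous function times the integrable power `(u-1)^{-2a}`, `-2a > -1`, on `[1, z]`.
[cite: Lawler2005, eq. (6.21)] -/
theorem intervalIntegrable_sameSideKernel_one (ha : a < 1 / 2) (z : ℝ) (hz : 1 ≤ z) :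
    IntervalIntegrable (sameSideKernel a) volume 1 z := by
  have h1 : IntervalIntegrable (fun u : ℝ ↦ (u - 1) ^ (-(2 * a))) volume 1 z := by
    have h := (intervalIntegral.intervalIntegrable_rpow' (a := 0) (b := z - 1)
      (r := -(2 * a)) (by linarith)).comp_sub_right 1
    simp only [zero_add, sub_add_cancel] at h
    exact h
  have h2 : ContinuousOn (fun u : ℝ ↦ u ^ (-(2 * a))) (uIcc 1 z) := by
    refine ContinuousOn.rpow_const continuousOn_id fun u hu ↦ Or.inl ?_
    rw [uIcc_of_le hz] at hu
    exact ne_of_gt (lt_of_lt_of_le one_pos hu.1)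
  exact h1.continuousOn_mul h2

/-- The kernel is integrable on `[1, z] ∪ [1, w]`-type intervals: `IntervalIntegrable K_a w z` for
`1 ≤ w, z` (`a < 1/2`). [folklore] -/
theorem intervalIntegrable_sameSideKernel' (ha : a < 1 / 2) {w z : ℝ} (hw : 1 ≤ w) (hz : 1 ≤ z) :
    IntervalIntegrable (sameSideKernel a) volume w z :=
  (intervalIntegrable_sameSideKernel_one ha w hw).symm.trans (intervalIntegrable_sameSideKernel_one ha z hz)

/-- **`h(z) - h(w) = ∫_w^z K_a` down to the endpoint `1`** (`1 ≤ w, z`, `a < 1/2`).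
[folklore] -/
theorem sameSideH_sub' (ha : a < 1 / 2) {w z : ℝ} (hw : 1 ≤ w) (hz : 1 ≤ z) :
    sameSideH a z - sameSideH a w = ∫ u in w..z, sameSideKernel a u := by
  simp only [sameSideH]
  rw [← integral_interval_sub_left (intervalIntegrable_sameSideKernel' ha (w := 2) (by norm_num) hz)
    (intervalIntegrable_sameSideKernel' ha (w := 2) (by norm_num) hw)]

/-- `h(z) - h(1) = ∫₁ᶻ K_a` (`a < 1/2`). [folklore] -/
theorem sameSideH_sub_one (ha : a < 1 / 2) {z : ℝ} (hz : 1 ≤ z) :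
    sameSideH a z - sameSideH a 1 = ∫ u in (1 : ℝ)..z, sameSideKernel a u :=
  sameSideH_sub' ha le_rfl hz

/-- **`h(1) < h(z)` for `z > 1`** (`a < 1/2`): the integrand is positive on `(1, z)`. [folklore] -/
theorem sameSideH_one_lt (ha : a < 1 / 2) {z : ℝ} (hz : 1 < z) : sameSideH a 1 < sameSideH a z := by
  have h := sameSideH_sub_one ha hz.le
  have hpos : 0 < ∫ u in (1 : ℝ)..z, sameSideKernel a u :=
    intervalIntegral_pos_of_pos_on (intervalIntegrable_sameSideKernel_one ha z hz.le)
      (fun u hu ↦ sameSideKernel_pos a hu.1) hz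
  linarith

/-- `h(1) ≤ h(z)` for `z ≥ 1` (`a < 1/2`). [folklore] -/
theorem sameSideH_one_le (ha : a < 1 / 2) {z : ℝ} (hz : 1 ≤ z) : sameSideH a 1 ≤ sameSideH a z := by
  rcases hz.eq_or_lt with rfl | hz'
  · exact le_rfl
  · exact (sameSideH_one_lt ha hz').le

/-- **`h` is continuous on `[1, ∞)`** (`a < 1/2`): a primitive of an interval-integrable function.
[folklore] -/
theorem continuousOn_sameSideH_Ici (ha : a < 1 / 2) : ContinuousOn (sameSideH a) (Ici 1) := by
  intro z hz
  have hz' : (1 : ℝ) ≤ z := hz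
  have hcont : ContinuousOn (sameSideH a) (uIcc 1 (z + 1)) := by
    have h := continuousOn_primitive_interval' (μ := volume) (f := sameSideKernel a) (a := 2)
      (b₁ := 1) (b₂ := z + 1) (intervalIntegrable_sameSideKernel_one ha (z + 1) (by linarith))
      (by rw [uIcc_of_le (by linarith)]; exact ⟨by norm_num, by linarith⟩)
    exact h
  rw [uIcc_of_le (by linarith)] at hcont
  have hzmem : z ∈ Icc 1 (z + 1) := ⟨hz', by linarith⟩
  have h1 : ContinuousWithinAt (sameSideH a) (Icc 1 (z + 1)) z := hcont z hzmem
  refine (h1.mono_of_mem_nhdsWithin ?_)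
  exact mem_nhdsWithin.2 ⟨Iio (z + 1), isOpen_Iio, by simp, fun u hu ↦ ⟨hu.2, le_of_lt hu.1⟩⟩

/-- **`h(1)` is the right limit `h(1+)`** (`a < 1/2`). [folklore] -/
theorem tendsto_sameSideH_one (ha : a < 1 / 2) :
    Tendsto (sameSideH a) (𝓝[>] 1) (𝓝 (sameSideH a 1)) :=
  ((continuousOn_sameSideH_Ici ha).continuousWithinAt self_mem_Ici).tendsto.mono_left
    (nhdsWithin_mono _ Ioi_subset_Ici_self)

/-! ### The end `+∞`: integrability for `a > 1/4` and the value `h(∞)` -/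

/-- **The kernel is integrable at `+∞` when `a > 1/4`**: `K_a ≤ 2^{2a} u^{-4a}` on `[2, ∞)`
(`sameSideKernel_le`) and `-4a < -1`. [cite: RohdeSchramm2005, Lemma 6.6] -/
theorem integrableOn_sameSideKernel_Ioi (ha : 1 / 4 < a) :
    IntegrableOn (sameSideKernel a) (Ioi 2) := by
  have ha0 : 0 ≤ a := by linarith
  have hdom : IntegrableOn (fun u : ℝ ↦ (2 : ℝ) ^ (2 * a) * u ^ (-(4 * a))) (Ioi 2) :=
    (integrableOn_Ioi_rpow_of_lt (by linarith) two_pos).const_mul _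
  refine hdom.mono' (((continuousOn_sameSideKernel a).mono
    (Ioi_subset_Ioi one_le_two)).aestronglyMeasurable measurableSet_Ioi) ?_
  refine (ae_restrict_iff' measurableSet_Ioi).2 (ae_of_all _ fun u hu ↦ ?_)
  have hu2 : (2 : ℝ) < u := hu
  rw [Real.norm_of_nonneg (sameSideKernel_pos a (lt_trans one_lt_two hu2)).le]
  exact sameSideKernel_le ha0 hu2.le

/-- The kernel is integrable on `(1, ∞)` for `1/4 < a < 1/2` (both ends). [folklore] -/
theorem integrableOn_sameSideKernel_Ioi_one (ha : 1 / 4 < a) (ha' : a < 1 / 2) :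
    IntegrableOn (sameSideKernel a) (Ioi 1) := by
  have h1 : IntegrableOn (sameSideKernel a) (Ioc 1 2) := by
    have h := (intervalIntegrable_sameSideKernel_one ha' 2 one_le_two).1
    exact h
  have h2 := integrableOn_sameSideKernel_Ioi ha
  have h12 : IntegrableOn (sameSideKernel a) (Ioc 1 2 ∪ Ioi 2) := h1.union h2
  rwa [Ioc_union_Ioi_eq_Ioi one_le_two] at h12

/-- **The value `h(∞)`** of the same-side scale function: `sameSideHTop a = ∫_{(2, ∞)} K_a`
(finite for `a > 1/4`; `h(2) = 0`). [cite: RohdeSchramm2005, Lemma 6.6] -/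
def sameSideHTop (a : ℝ) : ℝ :=
  ∫ u in Ioi (2 : ℝ), sameSideKernel a u

/-- **`h(z) → h(∞)` as `z → ∞`** (`a > 1/4`). [folklore] -/
theorem tendsto_sameSideH_atTop (ha : 1 / 4 < a) :
    Tendsto (sameSideH a) atTop (𝓝 (sameSideHTop a)) :=
  intervalIntegral_tendsto_integral_Ioi 2 (integrableOn_sameSideKernel_Ioi ha) tendsto_id

/-- **`h(z) < h(∞)` for every `z > 1`** (`a > 1/4`): `h` is strictly increasing with limit
`h(∞)`. [folklore] -/
theorem sameSideH_lt_sameSideHTop (ha : 1 / 4 < a) {z : ℝ} (hz : 1 < z) :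
    sameSideH a z < sameSideHTop a := by
  have hmono := strictMonoOn_sameSideH a
  have hz1 : (1 : ℝ) < z + 1 := by linarith
  have h1 : sameSideH a z < sameSideH a (z + 1) := hmono hz hz1 (by linarith)
  have h2 : sameSideH a (z + 1) ≤ sameSideHTop a := by
    refine ge_of_tendsto (tendsto_sameSideH_atTop ha) ?_
    filter_upwards [eventually_ge_atTop (z + 1)] with w hw
    have hw1 : (1 : ℝ) < w := by linarith
    exact hmono.monotoneOn hz1 hw1 hw
  exact h1.trans_le h2

/-- `h(1) < h(∞)` (`1/4 < a < 1/2`). [folklore] -/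
theorem sameSideH_one_lt_sameSideHTop (ha : 1 / 4 < a) (ha' : a < 1 / 2) :
    sameSideH a 1 < sameSideHTop a :=
  (sameSideH_one_lt ha' one_lt_two).trans (sameSideH_lt_sameSideHTop ha one_lt_two)

/-- **`h(∞) - h(1) = ∫_{(1, ∞)} K_a`** (`1/4 < a < 1/2`). [folklore] -/
theorem sameSideHTop_sub_sameSideH_one (ha : 1 / 4 < a) (ha' : a < 1 / 2) :
    sameSideHTop a - sameSideH a 1 = ∫ u in Ioi (1 : ℝ), sameSideKernel a u := by
  have h1 : sameSideH a 1 = -∫ u in (1 : ℝ)..2, sameSideKernel a u := by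
    rw [sameSideH, integral_symm]
  have h2 : ∫ u in Ioi (1 : ℝ), sameSideKernel a u =
      (∫ u in (1 : ℝ)..2, sameSideKernel a u) + ∫ u in Ioi (2 : ℝ), sameSideKernel a u := by
    have hI1 : IntegrableOn (sameSideKernel a) (Ioc 1 2) :=
      (intervalIntegrable_sameSideKernel_one ha' 2 one_le_two).1
    rw [intervalIntegral.integral_of_le one_le_two,
      ← setIntegral_union (Ioc_disjoint_Ioi_same (a := (1 : ℝ)) (b := 2)) measurableSet_Ioi hI1
        (integrableOn_sameSideKernel_Ioi ha), Ioc_union_Ioi_eq_Ioi one_le_two]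
  rw [h1, h2, sameSideHTop]
  ring

/-- `h(z) - h(1) < h(∞) - h(1)` and both are positive, packaged: for `z > 1`,
`0 < h(z) - h(1) < h(∞) - h(1)` (`1/4 < a < 1/2`). [folklore] -/
theorem sameSideH_sub_one_mem_Ioo (ha : 1 / 4 < a) (ha' : a < 1 / 2) {z : ℝ} (hz : 1 < z) :
    sameSideH a z - sameSideH a 1 ∈ Ioo 0 (sameSideHTop a - sameSideH a 1) :=
  ⟨sub_pos.2 (sameSideH_one_lt ha' hz), sub_lt_sub_right (sameSideH_lt_sameSideHTop ha hz) _⟩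

end Literature.Probability.RandomPlanarGeometry
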